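import Mathlib
import Literature.Analysis.FluidPDE.WholeSpaceIBP
import Literature.Analysis.FunctionSpaces.SobolevDomain
import HarnessLib.Audit

/-!
# Rung C1 of the crux `EulerZoomLiouville.PowerGaugeEulerLiouville`, weak → classical bridge I: A `C¹` FIELD THAT IS A
# DISTRIBUTIONAL GRADIENT IS A CLASSICAL GRADIENT (symmetry of `DG` from the weak identity; the segment potential)

Route №10 `EulerZoomLiouville` (NavierStokesRegularity), crux E = stmt-NavierStokesRegularity-19832, tenure rung C1,
registered residue `stub_selfSimilarExtremalRest`.  Lineage ns-typeII-p2 (gen 8).  Generic calculus on `ℝ³` serving the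
bridge «exactly self-similar class member with SMOOTH velocity profile ⇒ the profile solves CIV (3.3) classically for
SOME `C¹` pressure» (sequel file), which removes the pressure entirely from the bounded classical stratum of the crux.

* `fderiv_inner_symm_of_weakGradient` — if `G ∈ C¹(ℝ³; ℝ³)` and some function `P` satisfies
  `∫ P div η = ∫ ⟪G, η⟫` for every test field `η` (i.e. `∇P = −G` in `𝒟'`), then `DG` is SYMMETRIC:
  `⟪DG(z) a, b⟫ = ⟪DG(z) b, a⟫` (test with `η = (∂_a φ) b − (∂_b φ) a`, which is divergence free, integrate by parts,
  fundamental lemma of the calculus of variations);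
* `exists_potential_of_fderiv_inner_symm` — a `C¹` field with symmetric derivative on `ℝ³` is a classical gradient:
  there is `Q ∈ C¹` with `∇Q = G` (the segment potential `Q(y) = ∫₀¹ ⟪G(ty), y⟫ dt`, Poincaré's lemma for 1-forms on
  a star-shaped domain, differentiated under the integral sign).

WHAT THIS IS NOT: not NS, not E, not rung C1 — calculus lemmas. [folklore; Evans, *PDE*, §5.2.1 (weak derivatives);
Poincaré lemma]
-/

noncomputable section

-- flat `Theorems/<Route><Decl>…` files of one crux share the namespace of the crux (tree convention)
set_option linter.dupNamespace false

open MeasureTheory Set Filter Topology Metric Function InnerProductSpace intervalIntegral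
open scoped RealInnerProductSpace NNReal ContDiff Interval

namespace Summit.NavierStokesRegularity.NavierStokesRegularity.Theorems.PowerGaugeEulerLiouville.WeakToClassical

open Literature.Analysis Literature.Analysis.FluidPDE Literature.Analysis.FunctionSpaces

/-! ### A continuous function orthogonal to all test functions vanishes -/

/-- `⟪a, ∇θ(x)⟫ = Dθ(x) a` (restated locally; the same one-liner exists in other summit trees, e.g.
`…AnomalousDissipation…NoConicalEulerFlux.inner_gradient_right`, and in `Literature.Analysis.FluidPDE` files not imported here). [folklore] -/
theorem inner_gradient_eq_fderiv (θ : (EuclideanSpace ℝ (Fin 3)) → ℝ) (x a : (EuclideanSpace ℝ (Fin 3))) : ⟪a, gradient θ x⟫ = fderiv ℝ θ x a := by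
  rw [gradient, real_inner_comm, InnerProductSpace.toDual_symm_apply]

/-- **Fundamental lemma, continuous form**: a continuous `f : ℝ³ → ℝ` with `∫ φ f = 0` for every smooth compactly
supported `φ` vanishes identically. [folklore; Evans, *PDE*, §5.2.1] -/
theorem eq_zero_of_forall_integral_smul_eq_zero {f : (EuclideanSpace ℝ (Fin 3)) → ℝ} (hf : Continuous f)
    (h : ∀ φ : (EuclideanSpace ℝ (Fin 3)) → ℝ, ContDiff ℝ ∞ φ → HasCompactSupport φ → ∫ x, φ x • f x = 0) (x : (EuclideanSpace ℝ (Fin 3))) : f x = 0 := by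
  have hae : ∀ᵐ y ∂(volume : Measure (EuclideanSpace ℝ (Fin 3))), f y = 0 :=
    ae_eq_zero_of_integral_contDiff_smul_eq_zero hf.locallyIntegrable h
  have hopen : IsOpen {y : (EuclideanSpace ℝ (Fin 3)) | f y ≠ 0} := isOpen_ne_fun hf continuous_const
  have hzero : volume {y : (EuclideanSpace ℝ (Fin 3)) | f y ≠ 0} = 0 := ae_iff.1 hae
  have hempty : {y : (EuclideanSpace ℝ (Fin 3)) | f y ≠ 0} = ∅ := (hopen.measure_eq_zero_iff volume).1 hzero
  by_contra hx
  have : x ∈ ({y : (EuclideanSpace ℝ (Fin 3)) | f y ≠ 0} : Set (EuclideanSpace ℝ (Fin 3))) := hx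
  rw [hempty] at this
  exact this

/-! ### Symmetry of `DG` when `G` is a distributional gradient -/

/-- `∫ ⟪G, b⟫ ∂_a φ = −∫ φ ⟪DG a, b⟫` for `G ∈ C¹`, `φ ∈ C¹_c` (integration by parts along the constant field `a`).
[folklore; Leray 1934 §6 (1.11)] -/
theorem integral_inner_mul_fderiv_apply_eq {G : (EuclideanSpace ℝ (Fin 3)) → (EuclideanSpace ℝ (Fin 3))}
    (hG : ContDiff ℝ 1 G) {φ : (EuclideanSpace ℝ (Fin 3)) → ℝ} (hφ : ContDiff ℝ 1 φ)
    (hφc : HasCompactSupport φ) (a b : (EuclideanSpace ℝ (Fin 3))) :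
    ∫ y, ⟪G y, b⟫ * fderiv ℝ φ y a = -∫ y, φ y * ⟪fderiv ℝ G y a, b⟫ := by
  -- `θ = ⟪G, b⟫`, `u = φ • a`: `div u = ∂_a φ`, `⟪u, ∇θ⟫ = φ ⟪DG a, b⟫`
  have hθ : ContDiff ℝ 1 fun y => ⟪G y, b⟫ := hG.inner ℝ contDiff_const
  have hu : ContDiff ℝ 1 fun y => φ y • a := hφ.smul contDiff_const
  have huc : HasCompactSupport fun y => φ y • a := hφc.smul_right (f' := fun _ : (EuclideanSpace ℝ (Fin 3)) => a)
  have h := integral_mul_divergence_add_eq_zero_right hθ hu huc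
  have hdiv : ∀ y, VectorCalculus.divergence (fun y => φ y • a) y = fderiv ℝ φ y a := by
    intro y
    rw [divergence_smul_apply (hφ.differentiable one_ne_zero y) (differentiableAt_const a)]
    have h0 : VectorCalculus.divergence (fun _ : (EuclideanSpace ℝ (Fin 3)) => a) y = 0 := by
      unfold VectorCalculus.divergence
      rw [fderiv_const_apply, ContinuousLinearMap.toLinearMap_zero, map_zero]
    rw [h0, mul_zero, zero_add, inner_gradient_eq_fderiv]
  have hgrad : ∀ y, ⟪φ y • a, gradient (fun y => ⟪G y, b⟫) y⟫ = φ y * ⟪fderiv ℝ G y a, b⟫ := by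
    intro y
    rw [real_inner_smul_left, inner_gradient_eq_fderiv,
      fderiv_inner_apply ℝ (hG.differentiable one_ne_zero y) (differentiableAt_const b), fderiv_const_apply,
      _root_.zero_apply, inner_zero_right, zero_add]
  simp_rw [hdiv, hgrad] at h
  linarith

/-- **A `C¹` distributional gradient has a symmetric derivative.**  If `G ∈ C¹(ℝ³; ℝ³)` and a function `P` satisfies
`∫ P div η = ∫ ⟪G, η⟫` for every test field `η` (so `∇P = −G` in the sense of distributions), then
`⟪DG(z) a, b⟫ = ⟪DG(z) b, a⟫` for all `z, a, b`.  (Test with the divergence-free field `η = (∂_a φ) b − (∂_b φ) a`.)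
[folklore; Evans, *PDE*, §5.2.1] -/
theorem fderiv_inner_symm_of_weakGradient {P : (EuclideanSpace ℝ (Fin 3)) → ℝ}
    {G : (EuclideanSpace ℝ (Fin 3)) → (EuclideanSpace ℝ (Fin 3))} (hG : ContDiff ℝ 1 G)
    (hweak : ∀ η : (EuclideanSpace ℝ (Fin 3)) → (EuclideanSpace ℝ (Fin 3)), IsTestFunctionOn (⊤ : TopologicalSpace.Opens (EuclideanSpace ℝ (Fin 3))) η →
      ∫ y, P y * VectorCalculus.divergence η y = ∫ y, ⟪G y, η y⟫)
    (z a b : (EuclideanSpace ℝ (Fin 3))) : ⟪fderiv ℝ G z a, b⟫ = ⟪fderiv ℝ G z b, a⟫ := by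
  have hcont : Continuous fun y => ⟪fderiv ℝ G y b, a⟫ - ⟪fderiv ℝ G y a, b⟫ :=
    (((hG.continuous_fderiv one_ne_zero).clm_apply continuous_const).inner continuous_const).sub
      (((hG.continuous_fderiv one_ne_zero).clm_apply continuous_const).inner continuous_const)
  have key := eq_zero_of_forall_integral_smul_eq_zero hcont ?_ z
  · linarith
  intro φ hφ hφc
  have hφ1 : ContDiff ℝ 1 φ := hφ.of_le (by norm_cast)
  have hφ2 : ContDiff ℝ 2 φ := hφ.of_le (by norm_cast)
  -- the test field `η = (∂_a φ) b − (∂_b φ) a`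
  set η : (EuclideanSpace ℝ (Fin 3)) → (EuclideanSpace ℝ (Fin 3)) := fun y => (fderiv ℝ φ y a) • b - (fderiv ℝ φ y b) • a with hη
  have hda : ContDiff ℝ ∞ fun y => fderiv ℝ φ y a := hφ.fderiv_right (m := ∞) (by norm_cast) |>.clm_apply contDiff_const
  have hdb : ContDiff ℝ ∞ fun y => fderiv ℝ φ y b := hφ.fderiv_right (m := ∞) (by norm_cast) |>.clm_apply contDiff_const
  have hηs : ContDiff ℝ ∞ η := (hda.smul contDiff_const).sub (hdb.smul contDiff_const)
  have hηc : HasCompactSupport η :=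
    ((hφc.fderiv_apply (𝕜 := ℝ) a).smul_right (f' := fun _ : (EuclideanSpace ℝ (Fin 3)) => b)).sub
      ((hφc.fderiv_apply (𝕜 := ℝ) b).smul_right (f' := fun _ : (EuclideanSpace ℝ (Fin 3)) => a))
  have hηt : IsTestFunctionOn (⊤ : TopologicalSpace.Opens (EuclideanSpace ℝ (Fin 3))) η := ⟨hηs, hηc, by simp⟩
  -- `div η = D²φ(b)(a) − D²φ(a)(b) = 0`
  have hdiv : ∀ y, VectorCalculus.divergence η y = 0 := by
    intro y
    have h1 : DifferentiableAt ℝ (fun y => fderiv ℝ φ y a) y := hda.differentiable (by simp) y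
    have h2 : DifferentiableAt ℝ (fun y => fderiv ℝ φ y b) y := hdb.differentiable (by simp) y
    have hsplit : VectorCalculus.divergence η y =
        VectorCalculus.divergence (fun y => (fderiv ℝ φ y a) • b) y -
          VectorCalculus.divergence (fun y => (fderiv ℝ φ y b) • a) y := by
      unfold VectorCalculus.divergence
      rw [hη, fderiv_fun_sub (h1.smul_const b) (h2.smul_const a), ContinuousLinearMap.toLinearMap_sub, map_sub]
    have hza : VectorCalculus.divergence (fun _ : (EuclideanSpace ℝ (Fin 3)) => b) y = 0 := by
      unfold VectorCalculus.divergence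
      rw [fderiv_const_apply, ContinuousLinearMap.toLinearMap_zero, map_zero]
    have hzb : VectorCalculus.divergence (fun _ : (EuclideanSpace ℝ (Fin 3)) => a) y = 0 := by
      unfold VectorCalculus.divergence
      rw [fderiv_const_apply, ContinuousLinearMap.toLinearMap_zero, map_zero]
    rw [hsplit, divergence_smul_apply h1 (differentiableAt_const b), divergence_smul_apply h2 (differentiableAt_const a),
      hza, hzb, mul_zero, mul_zero, zero_add, zero_add, inner_gradient_eq_fderiv,
      inner_gradient_eq_fderiv]
    have hD2 : DifferentiableAt ℝ (fderiv ℝ φ) y :=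
      (hφ2.fderiv_right (m := 1) (by norm_cast)).differentiable one_ne_zero y
    have ha' : fderiv ℝ (fun y => fderiv ℝ φ y a) y b = fderiv ℝ (fderiv ℝ φ) y b a := by
      rw [fderiv_clm_apply hD2 (differentiableAt_const a), fderiv_const_apply, ContinuousLinearMap.comp_zero, zero_add,
        ContinuousLinearMap.flip_apply]
    have hb' : fderiv ℝ (fun y => fderiv ℝ φ y b) y a = fderiv ℝ (fderiv ℝ φ) y a b := by
      rw [fderiv_clm_apply hD2 (differentiableAt_const b), fderiv_const_apply, ContinuousLinearMap.comp_zero, zero_add,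
        ContinuousLinearMap.flip_apply]
    have hsymm : fderiv ℝ (fderiv ℝ φ) y b a = fderiv ℝ (fderiv ℝ φ) y a b :=
      (hφ2.contDiffAt.isSymmSndFDerivAt (by simp)) b a
    rw [ha', hb', hsymm, sub_self]
  -- the weak identity with this `η`
  have hw := hweak η hηt
  simp_rw [hdiv, mul_zero, MeasureTheory.integral_zero] at hw
  -- `∫ ⟪G, η⟫ = ∫ ⟪G,b⟫ ∂_aφ − ∫ ⟪G,a⟫ ∂_bφ = −∫ φ ⟪DG a, b⟫ + ∫ φ ⟪DG b, a⟫`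
  have hi1 : Integrable (fun y => ⟪G y, b⟫ * fderiv ℝ φ y a) volume :=
    ((hG.continuous.inner continuous_const).mul (hda.continuous)).integrable_of_hasCompactSupport
      ((hφc.fderiv_apply (𝕜 := ℝ) a).mul_left)
  have hi2 : Integrable (fun y => ⟪G y, a⟫ * fderiv ℝ φ y b) volume :=
    ((hG.continuous.inner continuous_const).mul (hdb.continuous)).integrable_of_hasCompactSupport
      ((hφc.fderiv_apply (𝕜 := ℝ) b).mul_left)
  have hexp : ∀ y, ⟪G y, η y⟫ = ⟪G y, b⟫ * fderiv ℝ φ y a - ⟪G y, a⟫ * fderiv ℝ φ y b := by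
    intro y
    simp only [hη, inner_sub_right, real_inner_smul_right]
    ring
  simp_rw [hexp] at hw
  rw [integral_sub hi1 hi2, integral_inner_mul_fderiv_apply_eq hG hφ1 hφc a b,
    integral_inner_mul_fderiv_apply_eq hG hφ1 hφc b a] at hw
  have hi3 : Integrable (fun y => φ y * ⟪fderiv ℝ G y a, b⟫) volume :=
    (hφ.continuous.mul (((hG.continuous_fderiv one_ne_zero).clm_apply continuous_const).inner
      continuous_const)).integrable_of_hasCompactSupport hφc.mul_right
  have hi4 : Integrable (fun y => φ y * ⟪fderiv ℝ G y b, a⟫) volume :=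
    (hφ.continuous.mul (((hG.continuous_fderiv one_ne_zero).clm_apply continuous_const).inner
      continuous_const)).integrable_of_hasCompactSupport hφc.mul_right
  have : ∫ y, φ y • (⟪fderiv ℝ G y b, a⟫ - ⟪fderiv ℝ G y a, b⟫) =
      (∫ y, φ y * ⟪fderiv ℝ G y b, a⟫) - ∫ y, φ y * ⟪fderiv ℝ G y a, b⟫ := by
    rw [← integral_sub hi4 hi3]
    refine integral_congr_ae (Eventually.of_forall fun y => ?_)
    simp only [smul_eq_mul]; ring
  rw [this]
  linarith

/-! ### The segment potential of a field with symmetric derivative -/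

/-- **Poincaré lemma for `C¹` fields with symmetric derivative on `ℝ³`**: if `G ∈ C¹` and `⟪DG(z)a, b⟫ = ⟪DG(z)b, a⟫`
everywhere, the segment potential `Q(y) = ∫₀¹ ⟪G(ty), y⟫ dt` satisfies `DQ(y) = ⟪G(y), ·⟫` (differentiation under the
integral sign + `d/dt (t G(ty)) = G(ty) + t DG(ty) y`). [folklore; Poincaré lemma] -/
theorem hasFDerivAt_segmentPotential {G : (EuclideanSpace ℝ (Fin 3)) → (EuclideanSpace ℝ (Fin 3))} (hG : ContDiff ℝ 1 G)
    (hsym : ∀ z a b : (EuclideanSpace ℝ (Fin 3)), ⟪fderiv ℝ G z a, b⟫ = ⟪fderiv ℝ G z b, a⟫) (y₀ : (EuclideanSpace ℝ (Fin 3))) :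
    HasFDerivAt (fun y : (EuclideanSpace ℝ (Fin 3)) => ∫ t in (0 : ℝ)..1, ⟪G (t • y), y⟫) (innerSL ℝ (G y₀)) y₀ := by
  have hGd : Differentiable ℝ G := hG.differentiable one_ne_zero
  have hGc : Continuous G := hG.continuous
  have hDGc : Continuous (fderiv ℝ G) := hG.continuous_fderiv one_ne_zero
  -- the integrand and its derivative in `y`
  set F : (EuclideanSpace ℝ (Fin 3)) → ℝ → ℝ := fun y t => ⟪G (t • y), y⟫ with hF
  set F' : (EuclideanSpace ℝ (Fin 3)) → ℝ → (EuclideanSpace ℝ (Fin 3)) →L[ℝ] ℝ := fun y t =>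
    t • (innerSL ℝ y).comp (fderiv ℝ G (t • y)) + innerSL ℝ (G (t • y)) with hF'
  have hdiff : ∀ t y, HasFDerivAt (fun y => F y t) (F' y t) y := by
    intro t y
    have h1 : HasFDerivAt (fun y : (EuclideanSpace ℝ (Fin 3)) => G (t • y))
        ((fderiv ℝ G (t • y)).comp (t • ContinuousLinearMap.id ℝ (EuclideanSpace ℝ (Fin 3)))) y :=
      (hGd (t • y)).hasFDerivAt.comp y ((hasFDerivAt_id y).const_smul t)
    have h2 := h1.inner ℝ (hasFDerivAt_id y)
    refine h2.congr_fderiv ?_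
    ext h
    simp only [hF', ContinuousLinearMap.coe_comp, Function.comp_apply, fderivInnerCLM_apply,
      ContinuousLinearMap.prod_apply, FunLike.coe_smul, Pi.smul_apply,
      ContinuousLinearMap.coe_id', id_eq, map_smul, _root_.add_apply, innerSL_apply_apply,
      smul_eq_mul, real_inner_smul_right, real_inner_comm]
    ring
  -- continuity facts
  have hFc : ∀ y, Continuous fun t => F y t := fun y =>
    (hGc.comp (continuous_id.smul continuous_const)).inner continuous_const
  have hF'c : ∀ y, Continuous fun t => F' y t := by
    intro y
    refine ((continuous_id.smul (continuous_const.clm_comp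
      (hDGc.comp (continuous_id.smul continuous_const))))).add ?_
    exact innerSL ℝ |>.continuous.comp (hGc.comp (continuous_id.smul continuous_const))
  -- a uniform bound on `ball y₀ 1 × [0,1]`
  obtain ⟨M₀, hM₀⟩ : ∃ M₀, ∀ z ∈ closedBall (0 : (EuclideanSpace ℝ (Fin 3))) (‖y₀‖ + 1), ‖G z‖ ≤ M₀ :=
    (isCompact_closedBall _ _).exists_bound_of_continuousOn hGc.continuousOn
  obtain ⟨M₁, hM₁⟩ : ∃ M₁, ∀ z ∈ closedBall (0 : (EuclideanSpace ℝ (Fin 3))) (‖y₀‖ + 1), ‖fderiv ℝ G z‖ ≤ M₁ :=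
    (isCompact_closedBall _ _).exists_bound_of_continuousOn hDGc.continuousOn
  have hmem : ∀ t ∈ Ι (0 : ℝ) 1, ∀ y ∈ ball y₀ 1, t • y ∈ closedBall (0 : (EuclideanSpace ℝ (Fin 3))) (‖y₀‖ + 1) := by
    intro t ht y hy
    rw [uIoc_of_le zero_le_one] at ht
    rw [mem_closedBall, dist_zero_right, norm_smul, Real.norm_of_nonneg ht.1.le]
    have hy' : ‖y‖ ≤ ‖y₀‖ + 1 := by
      rw [mem_ball] at hy
      have := norm_le_norm_add_norm_sub' y y₀
      rw [← dist_eq_norm] at this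
      linarith
    calc t * ‖y‖ ≤ 1 * ‖y‖ := mul_le_mul_of_nonneg_right ht.2 (norm_nonneg _)
      _ ≤ ‖y₀‖ + 1 := by rw [one_mul]; exact hy'
  have hbound : ∀ᵐ t ∂(volume : Measure ℝ), t ∈ Ι (0 : ℝ) 1 → ∀ y ∈ ball y₀ 1,
      ‖F' y t‖ ≤ (‖y₀‖ + 1) * M₁ + M₀ := by
    refine Eventually.of_forall fun t ht y hy => ?_
    have hty := hmem t ht y hy
    rw [uIoc_of_le zero_le_one] at ht
    have hy' : ‖y‖ ≤ ‖y₀‖ + 1 := by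
      rw [mem_ball] at hy
      have := norm_le_norm_add_norm_sub' y y₀
      rw [← dist_eq_norm] at this
      linarith
    have hM1nn : 0 ≤ M₁ := (norm_nonneg _).trans (hM₁ _ hty)
    have hA : ‖t • (innerSL ℝ y).comp (fderiv ℝ G (t • y))‖ ≤ (‖y₀‖ + 1) * M₁ := by
      rw [norm_smul, Real.norm_eq_abs, abs_of_nonneg ht.1.le]
      calc t * ‖(innerSL ℝ y).comp (fderiv ℝ G (t • y))‖
          ≤ 1 * ‖(innerSL ℝ y).comp (fderiv ℝ G (t • y))‖ :=
            mul_le_mul_of_nonneg_right ht.2 (norm_nonneg _)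
        _ ≤ ‖innerSL ℝ y‖ * ‖fderiv ℝ G (t • y)‖ := by
            rw [one_mul]; exact ContinuousLinearMap.opNorm_comp_le _ _
        _ ≤ (‖y₀‖ + 1) * M₁ := by
            rw [innerSL_apply_norm]
            exact mul_le_mul hy' (hM₁ _ hty) (norm_nonneg _) (by positivity)
    have hB : ‖innerSL ℝ (G (t • y))‖ ≤ M₀ := by
      rw [innerSL_apply_norm]; exact hM₀ _ hty
    exact (norm_add_le _ _).trans (add_le_add hA hB)
  have hkey := intervalIntegral.hasFDerivAt_integral_of_dominated_of_fderiv_le (μ := volume)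
    (F := F) (F' := F') (x₀ := y₀) (a := 0) (b := 1) (s := ball y₀ 1) (bound := fun _ => (‖y₀‖ + 1) * M₁ + M₀)
    (ball_mem_nhds y₀ one_pos)
    (Eventually.of_forall fun y => (hFc y).aestronglyMeasurable)
    ((hFc y₀).intervalIntegrable 0 1)
    (hF'c y₀).aestronglyMeasurable hbound intervalIntegrable_const
    (Eventually.of_forall fun t _ y _ => hdiff t y)
  -- the value of the derivative: `∫₀¹ F' y₀ t dt = ⟪G y₀, ·⟫`
  have hval : (∫ t in (0 : ℝ)..1, F' y₀ t) = innerSL ℝ (G y₀) := by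
    ext h
    rw [ContinuousLinearMap.intervalIntegral_apply ((hF'c y₀).intervalIntegrable 0 1), innerSL_apply_apply]
    -- `F' y₀ t h = d/dt ⟪t • G (t • y₀), h⟫`
    have hφ : ∀ t, HasDerivAt (fun t : ℝ => ⟪t • G (t • y₀), h⟫) (F' y₀ t h) t := by
      intro t
      have h1 : HasDerivAt (fun t : ℝ => t • y₀) y₀ t := by simpa using (hasDerivAt_id t).smul_const y₀
      have h2 : HasDerivAt (fun t : ℝ => G (t • y₀)) (fderiv ℝ G (t • y₀) y₀) t :=
        (hGd (t • y₀)).hasFDerivAt.comp_hasDerivAt t h1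
      have h3 : HasDerivAt (fun t : ℝ => t • G (t • y₀)) (G (t • y₀) + t • fderiv ℝ G (t • y₀) y₀) t := by
        have := (hasDerivAt_id' t).smul h2
        refine this.congr_deriv ?_
        rw [one_smul, add_comm]
      have h4 := h3.inner ℝ (hasDerivAt_const t h)
      refine h4.congr_deriv ?_
      simp only [hF', inner_zero_right, zero_add, _root_.add_apply,
        FunLike.coe_smul, Pi.smul_apply, ContinuousLinearMap.coe_comp, Function.comp_apply,
        innerSL_apply_apply, smul_eq_mul, inner_add_left, real_inner_smul_left]
      rw [real_inner_comm (fderiv ℝ G (t • y₀) h) y₀, hsym (t • y₀) h y₀]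
      ring
    rw [intervalIntegral.integral_eq_sub_of_hasDerivAt (fun t _ => hφ t)
      (((hF'c y₀).clm_apply continuous_const).intervalIntegrable 0 1)]
    simp
  rw [hval] at hkey
  exact hkey

/-- **A `C¹` field with symmetric derivative on `ℝ³` is a classical gradient of a `C¹` function.**
[folklore; Poincaré lemma] -/
theorem exists_potential_of_fderiv_inner_symm {G : (EuclideanSpace ℝ (Fin 3)) → (EuclideanSpace ℝ (Fin 3))} (hG : ContDiff ℝ 1 G)
    (hsym : ∀ z a b : (EuclideanSpace ℝ (Fin 3)), ⟪fderiv ℝ G z a, b⟫ = ⟪fderiv ℝ G z b, a⟫) :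
    ∃ Q : (EuclideanSpace ℝ (Fin 3)) → ℝ, ContDiff ℝ 1 Q ∧ ∀ y, gradient Q y = G y := by
  set Q : (EuclideanSpace ℝ (Fin 3)) → ℝ := fun y => ∫ t in (0 : ℝ)..1, ⟪G (t • y), y⟫ with hQ
  have hQd : ∀ y, HasFDerivAt Q (innerSL ℝ (G y)) y := hasFDerivAt_segmentPotential hG hsym
  refine ⟨Q, ?_, fun y => ?_⟩
  · rw [contDiff_one_iff_fderiv]
    refine ⟨fun y => (hQd y).differentiableAt, ?_⟩
    have e : fderiv ℝ Q = fun y => innerSL ℝ (G y) := funext fun y => (hQd y).fderiv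
    rw [e]
    exact (innerSL ℝ).continuous.comp hG.continuous
  · have h : HasGradientAt Q (G y) y := by
      rw [hasGradientAt_iff_hasFDerivAt]
      exact hQd y
    exact h.gradient

/-- **A `C¹` distributional gradient is a classical gradient**: if `G ∈ C¹(ℝ³; ℝ³)` and some `P` satisfies
`∫ P div η = ∫ ⟪G, η⟫` for all test fields `η`, then `G = ∇Q` for a `C¹` function `Q`.  (No claim is made about
`P` itself, which is only a.e.-defined.) [folklore; Evans, *PDE*, §5.2.1; Poincaré lemma] -/
theorem exists_potential_of_weakGradient {P : (EuclideanSpace ℝ (Fin 3)) → ℝ}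
    {G : (EuclideanSpace ℝ (Fin 3)) → (EuclideanSpace ℝ (Fin 3))} (hG : ContDiff ℝ 1 G)
    (hweak : ∀ η : (EuclideanSpace ℝ (Fin 3)) → (EuclideanSpace ℝ (Fin 3)), IsTestFunctionOn (⊤ : TopologicalSpace.Opens (EuclideanSpace ℝ (Fin 3))) η →
      ∫ y, P y * VectorCalculus.divergence η y = ∫ y, ⟪G y, η y⟫) :
    ∃ Q : (EuclideanSpace ℝ (Fin 3)) → ℝ, ContDiff ℝ 1 Q ∧ ∀ y, gradient Q y = G y :=
  exists_potential_of_fderiv_inner_symm hG (fderiv_inner_symm_of_weakGradient hG hweak)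

end Summit.NavierStokesRegularity.NavierStokesRegularity.Theorems.PowerGaugeEulerLiouville.WeakToClassical

end
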